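import Mathlib
import Summits.Ventures.PercRepro2.Defs
import Summits.Ventures.PercRepro2.Graph
import Summits.Ventures.PercRepro2.OneColourSwitch
import Summits.Ventures.PercRepro2.RegionHubSign
import Summits.Ventures.PercRepro2.SideSwitch
import Summits.Ventures.PercRepro2.M9NoPocketDefs
import Summits.Ventures.PercRepro2.M9GeneralDHD
import Summits.Ventures.PercRepro2.M9PocketRSEdgeTransfer
import Summits.Ventures.PercRepro2.M9PocketRootOnlyTransfer
import Summits.Ventures.PercRepro2.M9PocketRSDTransfer
import Summits.Ventures.PercRepro2.M9PocketRSDJoin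

/-!
# A cluster hanging from `{r, s, d}` — the worlds at a `K`-only point (blind cell PercRepro2,
p3 g42, 2026-08-30; `proofs/P3-POCKETRK.md` §10⁶ (a) (ii)–(vi))

With `L`, `F` as in `M9PocketRSDTransfer`, at a point with `d ∈ K₂` (every exit is
`Y`-reached) and `d ∉ M₂` (no `W`-path passes through `d`): off `L` the `Y`-world of `{r, s}`
is the `Y`-world of the three exits in `G − F` (`mem_K2_restrict_iff_of_notMem_rsd`) and the
`W`-world is that of `{r, s}` in `G − F` (`mem_M2_restrict_iff_of_notMem_rsd`); on `L` the same
with the `F`-graph (`mem_K2_F_iff_of_mem_rsd`, `mem_M2_F_iff_of_mem_rsd`); `d ∈ M₂` iff `d` is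
`W`-reached by a segment (`d_mem_M2_iff_rsd`); `Sep` is `Sep` of `G − F` together with
«`p, q` not `Y`-joined to `d`» (`sep2_iff_rsd`); `DOne` splits into the condition off `L` and
the admissibility of the `F`-colouring (`DOne_iff_rsd`); and the `W`-cluster of `d` is the
union of its two segments (`conn_compl_d_restrict_iff_rsd`, `conn_compl_d_F_iff_rsd`).  The
`W`-defect, `σ_pq` and the `W`-link are in `M9PocketRSDGlue`.  Own work; std axioms.
-/

namespace Summit.Ventures.PercRepro2

namespace NoPocket

open Finset Classical OneColourSwitch SideSwitch

variable {V : Type*} {E : Type*} {ends : E → Sym2 V} {p q r s d : V} {ω : Config E} {L : Set V}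

section WorldsRSD

variable (hL : ∀ e x y, ends e = s(x, y) → x ∈ L → y ∈ L ∨ y = r ∨ y = s ∨ y = d)
  (hr : r ∉ L) (hs : s ∉ L) (hd : d ∉ L)

/-- Every exit is `Y`-reached when `d ∈ K₂`. -/
lemma exit_mem_K2_of_mem {t : V} (ht : t = r ∨ t = s ∨ t = d) (hK : d ∈ K2 ends r s ω) :
    t ∈ K2 ends r s ω := by
  rcases ht with rfl | rfl | rfl
  · exact r_mem_K2 _ _ _
  · exact s_mem_K2 _ _ _
  · exact hK

/-- A vertex `Y`-joined to a `Y`-reached vertex is `Y`-reached. -/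
lemma mem_K2_of_conn_of_mem {t x : V} (ht : t ∈ K2 ends r s ω) (h : Conn ends ω t x) :
    x ∈ K2 ends r s ω := by
  rcases mem_K2_iff.1 ht with h' | h'
  · exact mem_K2_iff.2 (Or.inl (conn_trans h' h))
  · exact mem_K2_iff.2 (Or.inr (conn_trans h' h))

include hL hr hs hd in
/-- **Off `L`, the `Y`-world of `{r, s}` is the `Y`-world of the three exits in `G − F`**
(`d ∈ K₂`). -/
lemma mem_K2_restrict_iff_of_notMem_rsd (hK : d ∈ K2 ends r s ω) {x : V} (hx : x ∉ L) :
    x ∈ K2 ends r s ω ↔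
      (Conn (fun e : {e // e ∉ within ends (L ∪ {r, s, d} : Set V)} => ends e.1) (fun e => ω e.1)
          r x ∨
        Conn (fun e : {e // e ∉ within ends (L ∪ {r, s, d} : Set V)} => ends e.1) (fun e => ω e.1)
          s x ∨
        Conn (fun e : {e // e ∉ within ends (L ∪ {r, s, d} : Set V)} => ends e.1) (fun e => ω e.1)
          d x) := by
  constructor
  · intro h
    have key : ∀ t, (t = r ∨ t = s) → Conn ends ω t x →
        (Conn (fun e : {e // e ∉ within ends (L ∪ {r, s, d} : Set V)} => ends e.1) (fun e => ω e.1)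
          r x ∨
        Conn (fun e : {e // e ∉ within ends (L ∪ {r, s, d} : Set V)} => ends e.1) (fun e => ω e.1)
          s x ∨
        Conn (fun e : {e // e ∉ within ends (L ∪ {r, s, d} : Set V)} => ends e.1) (fun e => ω e.1)
          d x) := by
      intro t ht hc
      obtain ⟨t', ht', _, hc'⟩ := exists_exit_restrict_of_conn_rsd hL hr hs hd
        (ht.elim (fun h => Or.inl h) (fun h => Or.inr (Or.inl h))) hx hc
      rcases ht' with rfl | rfl | rfl
      · exact Or.inl hc'
      · exact Or.inr (Or.inl hc')
      · exact Or.inr (Or.inr hc')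
    rcases mem_K2_iff.1 h with h | h
    · exact key r (Or.inl rfl) h
    · exact key s (Or.inr rfl) h
  · rintro (h | h | h)
    · exact mem_K2_of_conn_of_mem (r_mem_K2 r s ω) (conn_of_conn_restrict h)
    · exact mem_K2_of_conn_of_mem (s_mem_K2 r s ω) (conn_of_conn_restrict h)
    · exact mem_K2_of_conn_of_mem hK (conn_of_conn_restrict h)

include hL hr hs hd in
/-- **On `L`, the `Y`-world of `{r, s}` is the `Y`-world of the three exits in the `F`-graph**
(`d ∈ K₂`). -/
lemma mem_K2_F_iff_of_mem_rsd (hK : d ∈ K2 ends r s ω) {x : V} (hx : x ∈ L) :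
    x ∈ K2 ends r s ω ↔
      (Conn (fun e : {e // ¬ (e ∉ within ends (L ∪ {r, s, d} : Set V))} => ends e.1)
          (fun e => ω e.1) r x ∨
        Conn (fun e : {e // ¬ (e ∉ within ends (L ∪ {r, s, d} : Set V))} => ends e.1)
          (fun e => ω e.1) s x ∨
        Conn (fun e : {e // ¬ (e ∉ within ends (L ∪ {r, s, d} : Set V))} => ends e.1)
          (fun e => ω e.1) d x) := by
  constructor
  · intro h
    have key : ∀ t, (t = r ∨ t = s) → Conn ends ω t x →
        (Conn (fun e : {e // ¬ (e ∉ within ends (L ∪ {r, s, d} : Set V))} => ends e.1)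
          (fun e => ω e.1) r x ∨
        Conn (fun e : {e // ¬ (e ∉ within ends (L ∪ {r, s, d} : Set V))} => ends e.1)
          (fun e => ω e.1) s x ∨
        Conn (fun e : {e // ¬ (e ∉ within ends (L ∪ {r, s, d} : Set V))} => ends e.1)
          (fun e => ω e.1) d x) := by
      intro t ht hc
      obtain ⟨t', ht', _, hc'⟩ := exists_exit_F_of_conn_rsd hL hr hs hd
        (ht.elim (fun h => Or.inl h) (fun h => Or.inr (Or.inl h))) hx hc
      rcases ht' with rfl | rfl | rfl
      · exact Or.inl hc'
      · exact Or.inr (Or.inl hc')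
      · exact Or.inr (Or.inr hc')
    rcases mem_K2_iff.1 h with h | h
    · exact key r (Or.inl rfl) h
    · exact key s (Or.inr rfl) h
  · rintro (h | h | h)
    · exact mem_K2_of_conn_of_mem (r_mem_K2 r s ω) (conn_of_conn_restrict h)
    · exact mem_K2_of_conn_of_mem (s_mem_K2 r s ω) (conn_of_conn_restrict h)
    · exact mem_K2_of_conn_of_mem hK (conn_of_conn_restrict h)

include hL hr hs hd in
/-- **A `W`-path from `r` or `s` to a vertex off `L` is a `W`-segment of `G − F`** when
`d ∉ M₂`: the last segment cannot start at `d`. -/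
lemma conn_compl_restrict_of_conn_compl_rsd (hM : d ∉ M2 ends r s ω) {t x : V}
    (ht : t = r ∨ t = s) (hx : x ∉ L) (h : Conn ends (OneColourSwitch.compl ω) t x) :
    Conn (fun e : {e // e ∉ within ends (L ∪ {r, s, d} : Set V)} => ends e.1)
      (OneColourSwitch.compl (fun e => ω e.1)) r x ∨
    Conn (fun e : {e // e ∉ within ends (L ∪ {r, s, d} : Set V)} => ends e.1)
      (OneColourSwitch.compl (fun e => ω e.1)) s x := by
  obtain ⟨t', ht', htt', hc'⟩ := exists_exit_restrict_of_conn_rsd (ω := OneColourSwitch.compl ω)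
    hL hr hs hd (ht.elim (fun h => Or.inl h) (fun h => Or.inr (Or.inl h))) hx h
  rcases ht' with rfl | rfl | rfl
  · exact Or.inl hc'
  · exact Or.inr hc'
  · exfalso
    apply hM
    rw [M2, ← K2, mem_K2_iff]
    rcases ht with rfl | rfl
    · exact Or.inl htt'
    · exact Or.inr htt'

include hL hr hs hd in
/-- **A `W`-path from `r` or `s` to a vertex of `L` is a `W`-segment of the `F`-graph** when
`d ∉ M₂`. -/
lemma conn_compl_F_of_conn_compl_rsd (hM : d ∉ M2 ends r s ω) {t x : V}
    (ht : t = r ∨ t = s) (hx : x ∈ L) (h : Conn ends (OneColourSwitch.compl ω) t x) :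
    Conn (fun e : {e // ¬ (e ∉ within ends (L ∪ {r, s, d} : Set V))} => ends e.1)
      (OneColourSwitch.compl (fun e => ω e.1)) r x ∨
    Conn (fun e : {e // ¬ (e ∉ within ends (L ∪ {r, s, d} : Set V))} => ends e.1)
      (OneColourSwitch.compl (fun e => ω e.1)) s x := by
  obtain ⟨t', ht', htt', hc'⟩ := exists_exit_F_of_conn_rsd (ω := OneColourSwitch.compl ω)
    hL hr hs hd (ht.elim (fun h => Or.inl h) (fun h => Or.inr (Or.inl h))) hx h
  rcases ht' with rfl | rfl | rfl
  · exact Or.inl hc'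
  · exact Or.inr hc'
  · exfalso
    apply hM
    rw [M2, ← K2, mem_K2_iff]
    rcases ht with rfl | rfl
    · exact Or.inl htt'
    · exact Or.inr htt'

include hL hr hs hd in
/-- **Off `L`, the `W`-world of `{r, s}` is that of `G − F`** (`d ∉ M₂`). -/
lemma mem_M2_restrict_iff_of_notMem_rsd (hM : d ∉ M2 ends r s ω) {x : V} (hx : x ∉ L) :
    x ∈ M2 ends r s ω ↔
      x ∈ M2 (fun e : {e // e ∉ within ends (L ∪ {r, s, d} : Set V)} => ends e.1) r s
        (fun e => ω e.1) := by
  rw [M2, ← K2, mem_K2_iff, M2, ← K2, mem_K2_iff]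
  constructor
  · rintro (h | h)
    · exact conn_compl_restrict_of_conn_compl_rsd hL hr hs hd hM (Or.inl rfl) hx h
    · exact conn_compl_restrict_of_conn_compl_rsd hL hr hs hd hM (Or.inr rfl) hx h
  · rintro (h | h)
    · exact Or.inl (conn_of_conn_restrict (ω := OneColourSwitch.compl ω) h)
    · exact Or.inr (conn_of_conn_restrict (ω := OneColourSwitch.compl ω) h)

include hL hr hs hd in
/-- **On `L`, the `W`-world of `{r, s}` is that of the `F`-graph** (`d ∉ M₂`). -/
lemma mem_M2_F_iff_of_mem_rsd (hM : d ∉ M2 ends r s ω) {x : V} (hx : x ∈ L) :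
    x ∈ M2 ends r s ω ↔
      x ∈ M2 (fun e : {e // ¬ (e ∉ within ends (L ∪ {r, s, d} : Set V))} => ends e.1) r s
        (fun e => ω e.1) := by
  rw [M2, ← K2, mem_K2_iff, M2, ← K2, mem_K2_iff]
  constructor
  · rintro (h | h)
    · exact conn_compl_F_of_conn_compl_rsd hL hr hs hd hM (Or.inl rfl) hx h
    · exact conn_compl_F_of_conn_compl_rsd hL hr hs hd hM (Or.inr rfl) hx h
  · rintro (h | h)
    · exact Or.inl (conn_of_conn_restrict (ω := OneColourSwitch.compl ω) h)
    · exact Or.inr (conn_of_conn_restrict (ω := OneColourSwitch.compl ω) h)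

include hL hr hs in
/-- **`d ∈ M₂` iff `d` is `W`-reached by a segment** of `G − F` or of the `F`-graph. -/
lemma d_mem_M2_iff_rsd :
    d ∈ M2 ends r s ω ↔
      d ∈ M2 (fun e : {e // e ∉ within ends (L ∪ {r, s, d} : Set V)} => ends e.1) r s
        (fun e => ω e.1) ∨
      d ∈ M2 (fun e : {e // ¬ (e ∉ within ends (L ∪ {r, s, d} : Set V))} => ends e.1) r s
        (fun e => ω e.1) := by
  rw [M2, ← K2, M2, ← K2, M2, ← K2]
  exact d_mem_K2_iff_rsd (ω := OneColourSwitch.compl ω) hL hr hs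

include hL hr hs hd in
/-- **`Sep` at a `K`-only point**: `Sep` of `G − F` together with «`p`, `q` not `Y`-joined to
`d` off `F`». -/
lemma sep2_iff_rsd (hK : d ∈ K2 ends r s ω) (hM : d ∉ M2 ends r s ω) (hp : p ∉ L) (hq : q ∉ L) :
    sep2 ends p q r s ω ↔
      sep2 (fun e : {e // e ∉ within ends (L ∪ {r, s, d} : Set V)} => ends e.1) p q r s
        (fun e => ω e.1) ∧
      ¬ Conn (fun e : {e // e ∉ within ends (L ∪ {r, s, d} : Set V)} => ends e.1) (fun e => ω e.1)
        p d ∧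
      ¬ Conn (fun e : {e // e ∉ within ends (L ∪ {r, s, d} : Set V)} => ends e.1) (fun e => ω e.1)
        q d := by
  constructor
  · rintro ⟨⟨h1, h2, h3, h4⟩, ⟨h5, h6, h7, h8⟩⟩
    refine ⟨⟨⟨fun h => h1 (conn_of_conn_restrict h), fun h => h2 (conn_of_conn_restrict h),
      fun h => h3 (conn_of_conn_restrict h), fun h => h4 (conn_of_conn_restrict h)⟩,
      ⟨fun h => h5 (conn_of_conn_restrict (ω := OneColourSwitch.compl ω) h),
      fun h => h6 (conn_of_conn_restrict (ω := OneColourSwitch.compl ω) h),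
      fun h => h7 (conn_of_conn_restrict (ω := OneColourSwitch.compl ω) h),
      fun h => h8 (conn_of_conn_restrict (ω := OneColourSwitch.compl ω) h)⟩⟩, ?_, ?_⟩
    · intro h
      have hpK : p ∈ K2 ends r s ω :=
        mem_K2_of_conn_of_mem hK (conn_symm (conn_of_conn_restrict h))
      rcases mem_K2_iff.1 hpK with h' | h'
      · exact h1 (conn_symm h')
      · exact h2 (conn_symm h')
    · intro h
      have hqK : q ∈ K2 ends r s ω :=
        mem_K2_of_conn_of_mem hK (conn_symm (conn_of_conn_restrict h))
      rcases mem_K2_iff.1 hqK with h' | h'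
      · exact h3 (conn_symm h')
      · exact h4 (conn_symm h')
  · rintro ⟨⟨⟨h1, h2, h3, h4⟩, ⟨h5, h6, h7, h8⟩⟩, hpd, hqd⟩
    -- `Y`: a `Y`-path from `r` or `s` to `p` ends with a segment of `G − F` from an exit
    have keyY : ∀ u, u ∉ L →
        ¬ Conn (fun e : {e // e ∉ within ends (L ∪ {r, s, d} : Set V)} => ends e.1)
          (fun e => ω e.1) u r →
        ¬ Conn (fun e : {e // e ∉ within ends (L ∪ {r, s, d} : Set V)} => ends e.1)
          (fun e => ω e.1) u s →
        ¬ Conn (fun e : {e // e ∉ within ends (L ∪ {r, s, d} : Set V)} => ends e.1)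
          (fun e => ω e.1) u d →
        ∀ t, (t = r ∨ t = s) → ¬ Conn ends ω u t := by
      intro u hu hur hus hud t ht hc
      obtain ⟨t', ht', _, hc'⟩ := exists_exit_restrict_of_conn_rsd hL hr hs hd
        (ht.elim (fun h => Or.inl h) (fun h => Or.inr (Or.inl h))) hu (conn_symm hc)
      rcases ht' with rfl | rfl | rfl
      · exact hur (conn_symm hc')
      · exact hus (conn_symm hc')
      · exact hud (conn_symm hc')
    -- `W`: no passage through `d`
    have keyW : ∀ u, u ∉ L →
        ¬ Conn (fun e : {e // e ∉ within ends (L ∪ {r, s, d} : Set V)} => ends e.1)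
          (OneColourSwitch.compl (fun e => ω e.1)) u r →
        ¬ Conn (fun e : {e // e ∉ within ends (L ∪ {r, s, d} : Set V)} => ends e.1)
          (OneColourSwitch.compl (fun e => ω e.1)) u s →
        ∀ t, (t = r ∨ t = s) → ¬ Conn ends (OneColourSwitch.compl ω) u t := by
      intro u hu hur hus t ht hc
      rcases conn_compl_restrict_of_conn_compl_rsd hL hr hs hd hM ht hu (conn_symm hc) with h | h
      · exact hur (conn_symm h)
      · exact hus (conn_symm h)
    exact ⟨⟨keyY p hp h1 h2 hpd r (Or.inl rfl), keyY p hp h1 h2 hpd s (Or.inr rfl),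
      keyY q hq h3 h4 hqd r (Or.inl rfl), keyY q hq h3 h4 hqd s (Or.inr rfl)⟩,
      ⟨keyW p hp h5 h6 r (Or.inl rfl), keyW p hp h5 h6 s (Or.inr rfl),
      keyW q hq h7 h8 r (Or.inl rfl), keyW q hq h7 h8 s (Or.inr rfl)⟩⟩

include hL hr hs hd in
/-- **`DOne` at a `K`-only point splits**: no vertex off `L` in both the `Y`-world of the exits
and the `W`-world of `{r, s}` in `G − F`, and the same on `L` in the `F`-graph (the
admissibility of the `F`-colouring). -/
lemma DOne_iff_rsd (hK : d ∈ K2 ends r s ω) (hM : d ∉ M2 ends r s ω) :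
    DOne ends r s d ω ↔
      (∀ x, x ∉ L → x ≠ r → x ≠ s → x ≠ d →
        (Conn (fun e : {e // e ∉ within ends (L ∪ {r, s, d} : Set V)} => ends e.1)
            (fun e => ω e.1) r x ∨
          Conn (fun e : {e // e ∉ within ends (L ∪ {r, s, d} : Set V)} => ends e.1)
            (fun e => ω e.1) s x ∨
          Conn (fun e : {e // e ∉ within ends (L ∪ {r, s, d} : Set V)} => ends e.1)
            (fun e => ω e.1) d x) →
        x ∉ M2 (fun e : {e // e ∉ within ends (L ∪ {r, s, d} : Set V)} => ends e.1) r s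
          (fun e => ω e.1)) ∧
      (∀ x ∈ L,
        (Conn (fun e : {e // ¬ (e ∉ within ends (L ∪ {r, s, d} : Set V))} => ends e.1)
            (fun e => ω e.1) r x ∨
          Conn (fun e : {e // ¬ (e ∉ within ends (L ∪ {r, s, d} : Set V))} => ends e.1)
            (fun e => ω e.1) s x ∨
          Conn (fun e : {e // ¬ (e ∉ within ends (L ∪ {r, s, d} : Set V))} => ends e.1)
            (fun e => ω e.1) d x) →
        x ∉ M2 (fun e : {e // ¬ (e ∉ within ends (L ∪ {r, s, d} : Set V))} => ends e.1) r s
          (fun e => ω e.1)) := by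
  constructor
  · intro h
    refine ⟨?_, ?_⟩
    · intro x hxL hxr hxs hxd hxK hxM
      exact h x hxr hxs hxd ((mem_K2_restrict_iff_of_notMem_rsd hL hr hs hd hK hxL).2 hxK)
        ((mem_M2_restrict_iff_of_notMem_rsd hL hr hs hd hM hxL).2 hxM)
    · intro x hxL hxK hxM
      have hxr : x ≠ r := fun h' => hr (h' ▸ hxL)
      have hxs : x ≠ s := fun h' => hs (h' ▸ hxL)
      have hxd : x ≠ d := fun h' => hd (h' ▸ hxL)
      exact h x hxr hxs hxd ((mem_K2_F_iff_of_mem_rsd hL hr hs hd hK hxL).2 hxK)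
        ((mem_M2_F_iff_of_mem_rsd hL hr hs hd hM hxL).2 hxM)
  · rintro ⟨h1, h2⟩ x hxr hxs hxd hxK hxM
    by_cases hxL : x ∈ L
    · exact h2 x hxL ((mem_K2_F_iff_of_mem_rsd hL hr hs hd hK hxL).1 hxK)
        ((mem_M2_F_iff_of_mem_rsd hL hr hs hd hM hxL).1 hxM)
    · exact h1 x hxL hxr hxs hxd ((mem_K2_restrict_iff_of_notMem_rsd hL hr hs hd hK hxL).1 hxK)
        ((mem_M2_restrict_iff_of_notMem_rsd hL hr hs hd hM hxL).1 hxM)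

include hL hr hs hd in
/-- **The `W`-cluster of `d` off `L` is its `W`-cluster in `G − F`** (`d ∉ M₂`). -/
lemma conn_compl_d_restrict_iff_rsd (hM : d ∉ M2 ends r s ω) {y : V} (hy : y ∉ L) :
    Conn ends (OneColourSwitch.compl ω) d y ↔
      Conn (fun e : {e // e ∉ within ends (L ∪ {r, s, d} : Set V)} => ends e.1)
        (OneColourSwitch.compl (fun e => ω e.1)) d y := by
  constructor
  · intro h
    obtain ⟨t', ht', htt', hc'⟩ := exists_exit_restrict_of_conn_rsd (ω := OneColourSwitch.compl ω)
      hL hr hs hd (Or.inr (Or.inr rfl)) hy h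
    rcases ht' with rfl | rfl | rfl
    · exfalso
      apply hM
      rw [M2, ← K2, mem_K2_iff]
      exact Or.inl (conn_symm htt')
    · exfalso
      apply hM
      rw [M2, ← K2, mem_K2_iff]
      exact Or.inr (conn_symm htt')
    · exact hc'
  · exact fun h => conn_of_conn_restrict (ω := OneColourSwitch.compl ω) h

include hL hr hs hd in
/-- **The `W`-cluster of `d` on `L` is its `W`-cluster in the `F`-graph** (`d ∉ M₂`). -/
lemma conn_compl_d_F_iff_rsd (hM : d ∉ M2 ends r s ω) {y : V} (hy : y ∈ L) :
    Conn ends (OneColourSwitch.compl ω) d y ↔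
      Conn (fun e : {e // ¬ (e ∉ within ends (L ∪ {r, s, d} : Set V))} => ends e.1)
        (OneColourSwitch.compl (fun e => ω e.1)) d y := by
  constructor
  · intro h
    obtain ⟨t', ht', htt', hc'⟩ := exists_exit_F_of_conn_rsd (ω := OneColourSwitch.compl ω)
      hL hr hs hd (Or.inr (Or.inr rfl)) hy h
    rcases ht' with rfl | rfl | rfl
    · exfalso
      apply hM
      rw [M2, ← K2, mem_K2_iff]
      exact Or.inl (conn_symm htt')
    · exfalso
      apply hM
      rw [M2, ← K2, mem_K2_iff]
      exact Or.inr (conn_symm htt')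
    · exact hc'
  · exact fun h => conn_of_conn_restrict (ω := OneColourSwitch.compl ω) h

end WorldsRSD

end NoPocket

end Summit.Ventures.PercRepro2
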